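import Mathlib.Topology.MetricSpace.HausdorffDistance
import Literature.Analysis.FluidPDE.StatisticalSolution
import Literature.Analysis.FluidPDE.TurbWave0
import HarnessLib

/-!
# Time-average measures on the energy space: generalized limits and the support

Analysis/FluidPDE support file for the discharge of
`Literature.Analysis.FluidPDE.timeAverage_isStationary` (Foias–Manley–Rosa–Temam 2001, Ch. IV
Thm. 3.1: time-average measures of a Leray–Hopf solution are stationary statistical solutions).

A time-average measure (`Torus.IsTimeAverageMeasure Λ.longTimeAvg U μ`, accepted
`StatisticalSolution`) is a Borel probability measure `μ` on `H` with
`∫ Ψ dμ = Λ (T ↦ T⁻¹ ∫₀ᵀ Ψ(U t) dt)` for every **bounded norm-continuous** observable `Ψ`, `Λ`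
being a generalized (Banach) limit at `+∞` (`GeneralizedLimit`, accepted `TurbWave0`). This file
provides the elementary calculus the printed proof (FMRT 2001, Ch. IV §3.1 and App. B.2,
PDF pp. 208–210, 255–262) uses without comment:

* `GeneralizedLimit.apply_const`, `…apply_nonneg`, `…apply_mono`, `…apply_eq_of_eventuallyEq`,
  `…apply_le_of_eventually_le`, `…le_apply_of_eventually_le` — property (1.35) (positivity),
  (1.37) (`liminf ≤ Lim ≤ limsup`) and the fact that `Lim` only depends on the germ at `+∞`
  (by linearity and `Lim = lim` on convergent functions, so no boundedness is needed there);
* `abs_timeMean_le`, `timeMean_congr`, boundedness of the Cesàro means of a bounded function;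
* `Torus.IsTimeAverageMeasure.measure_compl_eq_zero` — **support**: if the trajectory stays in
  a closed set `K` from some time on, then `μ(H ∖ K) = 0` (test `min(dist(·, K), 1)`, whose time
  means are `O(1/T)`; FMRT p. 209: "Clearly `μ(H ∖ K_w) = 0`");
* `Torus.IsTimeAverageMeasure.integral_eq_of_eqOn` — the defining identity extends to every
  continuous `Ψ` that agrees on such a `K` with a bounded continuous observable (FMRT Cor. 3.1,
  p. 209, in the norm topology), with integrability of `Ψ`;
* `Torus.IsTimeAverageMeasure.integral_le_of_forall_timeMean_le` — for `0 ≤ Ψ` bounded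
  continuous, an eventual bound `T⁻¹ ∫₀ᵀ k ≥ T⁻¹ ∫₀ᵀ Ψ(U t)` by time means of an integrable
  majorant `k ≥ Ψ ∘ U` passes to `∫ Ψ dμ` (positivity of `Lim`, FMRT p. 210, proof of (1.29)).

Only `t ≥ 0` matters: `timeMean g T` for `T > 0` integrates over `(0, T]`, and two functions
that agree on `(0, ∞)` have the same generalized long-time average.

## Mathlib search

Used: `Filter.limsup_le_of_le`, `Filter.le_liminf_of_le`, `IsBoundedUnder.isCoboundedUnder_le/ge`,
`intervalIntegral.norm_integral_le_of_norm_le_const`, `MeasureTheory.integral_indicator`,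
`norm_setIntegral_le_of_norm_le_const`, `Metric.continuous_infDist_pt`,
`IsClosed.mem_iff_infDist_zero`, `MeasureTheory.integral_mono_of_nonneg`,
`integral_eq_zero_iff_of_nonneg`. Nothing on generalized/Banach limits exists in Mathlib
(searched `Banach limit`, `generalized limit`, `invariant mean`).

## References

* C. Foias, O. Manley, R. Rosa, R. Temam, *Navier–Stokes Equations and Turbulence*, Cambridge
  Univ. Press (2001), Ch. IV §1.3 Def. 1.4, (1.35)–(1.40) (PDF pp. 200–201); §3.1 Def. 3.1,
  Prop. 3.1, Cor. 3.1, Thm. 3.1 (PDF pp. 208–210). [FMRT2001]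
-/

noncomputable section

open MeasureTheory Filter Topology Set

namespace Literature.Analysis.FluidPDE

/-! ### Generalized limits: constants, positivity, monotonicity, germ at `+∞` -/

namespace GeneralizedLimit

variable (Λ : GeneralizedLimit)

/-- A generalized limit of a constant function is that constant (FMRT 2001, Ch. IV (1.36):
`Lim` extends `lim`). [cite: FMRT2001, Ch. IV §1.3 Def. 1.4 (ii)] -/
theorem apply_const (c : ℝ) : Λ (fun _ : ℝ => c) = c :=
  Λ.apply_eq_of_tendsto tendsto_const_nhds

/-- Two functions with the same germ at `+∞` have the same generalized limit: their difference
tends to `0`, on which `Lim = lim = 0`, and `Lim` is linear (FMRT 2001, Ch. IV §1.3; no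
boundedness is needed). [cite: FMRT2001, Ch. IV §1.3 Def. 1.4] -/
theorem apply_eq_of_eventuallyEq {g h : ℝ → ℝ} (heq : g =ᶠ[atTop] h) : Λ g = Λ h := by
  have h0 : Λ (h - g) = 0 := by
    refine Λ.apply_eq_of_tendsto ?_
    have : (fun _ : ℝ => (0 : ℝ)) =ᶠ[atTop] (h - g) :=
      heq.mono fun _ ht => by simp [ht]
    exact tendsto_const_nhds.congr' this
  rw [map_sub] at h0
  linarith

/-- **Positivity** of generalized limits (FMRT 2001, Ch. IV (1.35)): an eventually nonnegative
function which is bounded above near `+∞` has `Lim g ≥ 0` (`0 ≤ liminf g ≤ Lim g`). [cite: FMRT2001, Ch. IV §1.3 (1.35)] -/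
theorem apply_nonneg {g : ℝ → ℝ} (hb : IsBoundedUnder (· ≤ ·) atTop g)
    (h : ∀ᶠ t in atTop, 0 ≤ g t) : 0 ≤ Λ g := by
  have hb' : IsBoundedUnder (· ≥ ·) atTop g := ⟨0, h.mono fun t ht => ht⟩
  exact (le_liminf_of_le hb.isCoboundedUnder_ge h).trans (Λ.liminf_le hb hb')

/-- An eventual upper bound passes to the generalized limit (`Lim g ≤ limsup g ≤ c`,
FMRT 2001, Ch. IV (1.37)). [cite: FMRT2001, Ch. IV §1.3 (1.37)] -/
theorem apply_le_of_eventually_le {g : ℝ → ℝ} {c : ℝ} (hb : IsBoundedUnder (· ≥ ·) atTop g)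
    (h : ∀ᶠ t in atTop, g t ≤ c) : Λ g ≤ c :=
  (Λ.le_limsup ⟨c, h⟩ hb).trans (limsup_le_of_le hb.isCoboundedUnder_le h)

/-- An eventual lower bound passes to the generalized limit (`c ≤ liminf g ≤ Lim g`,
FMRT 2001, Ch. IV (1.37)). [cite: FMRT2001, Ch. IV §1.3 (1.37)] -/
theorem le_apply_of_eventually_le {g : ℝ → ℝ} {c : ℝ} (hb : IsBoundedUnder (· ≤ ·) atTop g)
    (h : ∀ᶠ t in atTop, c ≤ g t) : c ≤ Λ g :=
  (le_liminf_of_le hb.isCoboundedUnder_ge h).trans (Λ.liminf_le hb ⟨c, h.mono fun _ ht => ht⟩)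

/-- **Monotonicity** of generalized limits on eventually bounded functions
(FMRT 2001, Ch. IV (1.35) applied to `h - g ≥ 0`). [cite: FMRT2001, Ch. IV §1.3 (1.35)] -/
theorem apply_mono {g h : ℝ → ℝ} (hg : IsBoundedUnder (· ≥ ·) atTop g)
    (hh : IsBoundedUnder (· ≤ ·) atTop h) (hle : ∀ᶠ t in atTop, g t ≤ h t) : Λ g ≤ Λ h := by
  obtain ⟨b, hb⟩ := hg
  obtain ⟨B, hB⟩ := hh
  have hb' : ∀ᶠ t in atTop, b ≤ g t := hb
  have hB' : ∀ᶠ t in atTop, h t ≤ B := hB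
  have hsub : 0 ≤ Λ (h - g) := by
    refine Λ.apply_nonneg ⟨B - b, ?_⟩ (hle.mono fun t ht => sub_nonneg.2 ht)
    have : ∀ᶠ t in atTop, (h - g) t ≤ B - b := by
      filter_upwards [hb', hB'] with t h1 h2
      exact sub_le_sub h2 h1
    exact this
  rw [map_sub] at hsub
  linarith

/-- `|Lim g| ≤ C` when `|g| ≤ C` eventually (FMRT 2001, Ch. IV (1.38)). [cite: FMRT2001, Ch. IV §1.3 (1.38)] -/
theorem abs_apply_le {g : ℝ → ℝ} {C : ℝ} (h : ∀ᶠ t in atTop, |g t| ≤ C) : |Λ g| ≤ C := by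
  have h₁ : ∀ᶠ t in atTop, g t ≤ C := h.mono fun t ht => (abs_le.1 ht).2
  have h₂ : ∀ᶠ t in atTop, -C ≤ g t := h.mono fun t ht => (abs_le.1 ht).1
  exact abs_le.2 ⟨Λ.le_apply_of_eventually_le ⟨C, h₁⟩ h₂,
    Λ.apply_le_of_eventually_le ⟨-C, h₂.mono fun t ht => ht⟩ h₁⟩

end GeneralizedLimit

/-! ### Cesàro means of functions that are bounded on `(0, ∞)` -/

/-- The time mean over `[0, T]`, `T > 0`, of a function bounded by `C` on `(0, T]` is bounded
by `C` (no measurability needed: a non-integrable function has mean `0`). [folklore] -/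
theorem abs_timeMean_le {g : ℝ → ℝ} {C : ℝ} {T : ℝ} (hT : 0 < T)
    (h : ∀ t, 0 < t → t ≤ T → |g t| ≤ C) : |timeMean g T| ≤ C := by
  unfold timeMean
  have h1 : ‖∫ t in (0 : ℝ)..T, g t‖ ≤ C * |T - 0| :=
    intervalIntegral.norm_integral_le_of_norm_le_const fun t ht => by
      rw [uIoc_of_le hT.le] at ht
      rw [Real.norm_eq_abs]
      exact h t ht.1 ht.2
  rw [sub_zero, abs_of_pos hT, Real.norm_eq_abs] at h1
  rw [abs_mul, abs_inv, abs_of_pos hT]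
  calc T⁻¹ * |∫ t in (0 : ℝ)..T, g t| ≤ T⁻¹ * (C * T) := by gcongr
    _ = C := by field_simp

/-- Functions that agree on `(0, ∞)` have the same time means over `[0, T]`, `T ≥ 0`. [folklore] -/
theorem timeMean_congr {g h : ℝ → ℝ} (heq : ∀ t, 0 < t → g t = h t) {T : ℝ} (hT : 0 ≤ T) :
    timeMean g T = timeMean h T := by
  unfold timeMean
  congr 1
  refine intervalIntegral.integral_congr_ae (Eventually.of_forall fun t ht => ?_)
  rw [uIoc_of_le hT] at ht
  exact heq t ht.1

/-- Functions that agree on `(0, ∞)` have eventually equal time means. [folklore] -/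
theorem timeMean_eventuallyEq {g h : ℝ → ℝ} (heq : ∀ t, 0 < t → g t = h t) :
    timeMean g =ᶠ[atTop] timeMean h :=
  (eventually_ge_atTop 0).mono fun _ hT => timeMean_congr heq hT

/-- The time means of a function bounded by `C` on `(0, ∞)` are eventually bounded above by `C`.
[folklore] -/
theorem isBoundedUnder_le_timeMean {g : ℝ → ℝ} {C : ℝ}
    (h : ∀ t, 0 < t → |g t| ≤ C) : IsBoundedUnder (· ≤ ·) atTop (timeMean g) :=
  ⟨C, (eventually_gt_atTop 0).mono fun _ hT =>
    (abs_le.1 (abs_timeMean_le hT fun t ht _ => h t ht)).2⟩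

/-- The time means of a function bounded by `C` on `(0, ∞)` are eventually bounded below by
`-C`. [folklore] -/
theorem isBoundedUnder_ge_timeMean {g : ℝ → ℝ} {C : ℝ}
    (h : ∀ t, 0 < t → |g t| ≤ C) : IsBoundedUnder (· ≥ ·) atTop (timeMean g) :=
  ⟨-C, (eventually_gt_atTop 0).mono fun _ hT =>
    (abs_le.1 (abs_timeMean_le hT fun t ht _ => h t ht)).1⟩

/-- The generalized long-time averages of two functions that agree on `(0, ∞)` coincide. [folklore] -/
theorem GeneralizedLimit.longTimeAvg_congr (Λ : GeneralizedLimit) {g h : ℝ → ℝ}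
    (heq : ∀ t, 0 < t → g t = h t) : Λ.longTimeAvg g = Λ.longTimeAvg h :=
  Λ.apply_eq_of_eventuallyEq (timeMean_eventuallyEq heq)

/-- `|⟨g⟩_Λ| ≤ C` for a function bounded by `C` on `(0, ∞)`. [folklore] -/
theorem GeneralizedLimit.abs_longTimeAvg_le (Λ : GeneralizedLimit) {g : ℝ → ℝ} {C : ℝ}
    (h : ∀ t, 0 < t → |g t| ≤ C) : |Λ.longTimeAvg g| ≤ C :=
  Λ.abs_apply_le ((eventually_gt_atTop 0).mono fun _ hT =>
    abs_timeMean_le hT fun t ht _ => h t ht)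

/-! ### Time-average measures: support and extension of the defining identity -/

namespace Torus

variable {d : Type*} [Fintype d] [DecidableEq d]

variable {Λ : GeneralizedLimit} {U : ℝ → FunctionSpaces.Torus.energySpace d}
  {μ : Measure (FunctionSpaces.Torus.energySpace d)}

/-- A real function with `|Ψ| ≤ C` has bounded range. [folklore] -/
theorem isBounded_range_of_abs_le {α : Type*} {Ψ : α → ℝ} {C : ℝ} (h : ∀ u, |Ψ u| ≤ C) :
    Bornology.IsBounded (range Ψ) :=
  (Metric.isBounded_Icc (-C) C).subset (range_subset_iff.2 fun u => abs_le.1 (h u))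

/-- The defining identity of a time-average measure for an observable with `|Ψ| ≤ C`
(FMRT 2001, Ch. IV Def. 3.1 (3.1)). [cite: FMRT2001, Ch. IV §3.1 Def. 3.1] -/
theorem IsTimeAverageMeasure.integral_eq (hμ : IsTimeAverageMeasure Λ.longTimeAvg U μ)
    {Ψ : FunctionSpaces.Torus.energySpace d → ℝ} (hΨ : Continuous Ψ) {C : ℝ} (hC : ∀ u, |Ψ u| ≤ C) :
    ∫ v, Ψ v ∂μ = Λ.longTimeAvg (fun t => Ψ (U t)) :=
  hμ.2 Ψ hΨ (isBounded_range_of_abs_le hC)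

/-- **Support of a time-average measure.** If the trajectory stays in a closed set `K` for all
`t ≥ t₀` (`t₀ ≥ 0`), then `μ(H ∖ K) = 0`: the bounded continuous observable
`Ψ = min(dist(·, K), 1)` vanishes along the trajectory after `t₀`, so its time means are
`O(t₀/T) → 0` and `∫ Ψ dμ = 0`, whence `Ψ = 0` `μ`-a.e., i.e. `μ`-a.e. point lies in `K`
(FMRT 2001, Ch. IV, proof of Prop. 3.1, p. 209: "`μ(H ∖ K_w) = 0`"). [cite: FMRT2001, Ch. IV §3.1 Prop. 3.1] -/
theorem IsTimeAverageMeasure.measure_compl_eq_zero (hμ : IsTimeAverageMeasure Λ.longTimeAvg U μ)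
    {K : Set (FunctionSpaces.Torus.energySpace d)} (hK : IsClosed K) {t₀ : ℝ} (ht₀ : 0 ≤ t₀)
    (hU : ∀ t, t₀ ≤ t → U t ∈ K) : μ Kᶜ = 0 := by
  haveI := hμ.1
  have hKne : K.Nonempty := ⟨U t₀, hU t₀ le_rfl⟩
  set Ψ : FunctionSpaces.Torus.energySpace d → ℝ := fun u => min (Metric.infDist u K) 1 with hΨ
  have hΨc : Continuous Ψ := (Metric.continuous_infDist_pt K).min continuous_const
  have hΨ0 : ∀ u, 0 ≤ Ψ u := fun u => le_min Metric.infDist_nonneg zero_le_one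
  have hΨ1 : ∀ u, |Ψ u| ≤ 1 := fun u => by
    rw [abs_of_nonneg (hΨ0 u)]
    exact min_le_right _ _
  have hΨU : ∀ t, t₀ ≤ t → Ψ (U t) = 0 := fun t ht => by
    have : Metric.infDist (U t) K = 0 := Metric.infDist_zero_of_mem (hU t ht)
    simp [hΨ, this]
  -- the time means are `O(1/T)`
  have hmean : Tendsto (timeMean fun t => Ψ (U t)) atTop (𝓝 0) := by
    have hbound : ∀ T, t₀ < T → |timeMean (fun t => Ψ (U t)) T| ≤ t₀ * T⁻¹ := by
      intro T hT
      have hT0 : 0 < T := ht₀.trans_lt hT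
      unfold timeMean
      rw [intervalIntegral.integral_of_le hT0.le]
      have hind : (fun t => Ψ (U t)) = (Iic t₀).indicator (fun t => Ψ (U t)) := by
        funext t
        by_cases ht : t ∈ Iic t₀
        · rw [indicator_of_mem ht]
        · rw [indicator_of_notMem ht, hΨU t (le_of_lt (not_le.1 ht))]
      rw [hind, integral_indicator measurableSet_Iic, Measure.restrict_restrict measurableSet_Iic]
      have hle : ‖∫ t in Iic t₀ ∩ Ioc 0 T, Ψ (U t)‖ ≤ 1 * volume.real (Iic t₀ ∩ Ioc 0 T) :=
        norm_setIntegral_le_of_norm_le_const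
          ((measure_mono inter_subset_right).trans_lt measure_Ioc_lt_top)
          fun t _ => by rw [Real.norm_eq_abs]; exact hΨ1 _
      have hvol : volume.real (Iic t₀ ∩ Ioc 0 T) ≤ t₀ := by
        have hsub : Iic t₀ ∩ Ioc 0 T ⊆ Ioc 0 t₀ := fun t ht => ⟨ht.2.1, ht.1⟩
        calc volume.real (Iic t₀ ∩ Ioc 0 T) ≤ volume.real (Ioc 0 t₀) :=
              measureReal_mono hsub measure_Ioc_lt_top.ne
          _ = t₀ := by rw [Real.volume_real_Ioc_of_le ht₀, sub_zero]
      rw [Real.norm_eq_abs, one_mul] at hle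
      rw [abs_mul, abs_inv, abs_of_pos hT0, mul_comm]
      exact mul_le_mul_of_nonneg_right (hle.trans hvol) (inv_nonneg.2 hT0.le)
    have hlim : Tendsto (fun T : ℝ => t₀ * T⁻¹) atTop (𝓝 0) := by
      simpa using tendsto_inv_atTop_zero.const_mul t₀
    refine squeeze_zero_norm' ?_ hlim
    filter_upwards [eventually_gt_atTop t₀] with T hT
    rw [Real.norm_eq_abs]
    exact hbound T hT
  -- hence `∫ Ψ dμ = 0` and `Ψ = 0` a.e.
  have hint : ∫ v, Ψ v ∂μ = 0 := by
    rw [hμ.integral_eq hΨc hΨ1]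
    exact Λ.longTimeAvg_eq_of_tendsto hmean
  have hΨi : Integrable Ψ μ :=
    Integrable.of_bound hΨc.aestronglyMeasurable 1 (ae_of_all _ fun u => by
      rw [Real.norm_eq_abs]; exact hΨ1 u)
  have hae : Ψ =ᵐ[μ] 0 := (integral_eq_zero_iff_of_nonneg (fun u => hΨ0 u) hΨi).1 hint
  have hnull : μ {u | ¬Ψ u = (0 : FunctionSpaces.Torus.energySpace d → ℝ) u} = 0 := ae_iff.1 hae
  refine measure_mono_null (fun u hu => ?_) hnull
  have hpos : 0 < Metric.infDist u K := (hK.notMem_iff_infDist_pos hKne).1 hu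
  exact (lt_min hpos zero_lt_one).ne'

/-- **Extension of the defining identity** (FMRT 2001, Ch. IV Cor. 3.1, p. 209, norm-topology
version). Let the trajectory stay in a closed set `K` for `t ≥ 0`, let `Ψ : H → ℝ` be any
function and let `Ψ'` be a bounded continuous observable with `Ψ = Ψ'` on `K`. Then `Ψ` is `μ`-integrable
and `∫ Ψ dμ = Lim T⁻¹ ∫₀ᵀ Ψ(U t) dt`: indeed `Ψ = Ψ'` `μ`-a.e. (`μ(H ∖ K) = 0`) and along the
trajectory, and the generalized long-time average only sees `t > 0`. [cite: FMRT2001, Ch. IV §3.1 Cor. 3.1] -/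
theorem IsTimeAverageMeasure.integral_eq_of_eqOn (hμ : IsTimeAverageMeasure Λ.longTimeAvg U μ)
    {K : Set (FunctionSpaces.Torus.energySpace d)} (hK : IsClosed K) (hU : ∀ t, 0 ≤ t → U t ∈ K)
    {Ψ Ψ' : FunctionSpaces.Torus.energySpace d → ℝ} (hΨ' : Continuous Ψ')
    {C : ℝ} (hC : ∀ u, |Ψ' u| ≤ C) (heq : EqOn Ψ Ψ' K) :
    Integrable Ψ μ ∧ ∫ v, Ψ v ∂μ = Λ.longTimeAvg (fun t => Ψ (U t)) := by
  haveI := hμ.1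
  have hnull := hμ.measure_compl_eq_zero hK le_rfl hU
  have hae : Ψ =ᵐ[μ] Ψ' := by
    have : ∀ᵐ u ∂μ, u ∈ K := by
      rw [ae_iff]
      exact hnull
    exact this.mono fun u hu => heq hu
  have hΨ'i : Integrable Ψ' μ :=
    Integrable.of_bound hΨ'.aestronglyMeasurable C (ae_of_all _ fun u => by
      rw [Real.norm_eq_abs]; exact hC u)
  refine ⟨hΨ'i.congr hae.symm, ?_⟩
  rw [integral_congr_ae hae, hμ.integral_eq hΨ' hC]
  exact Λ.longTimeAvg_congr fun t ht => (heq (hU t ht.le)).symm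

/-- **Upper bounds through time means of a majorant** (positivity of `Lim`; FMRT 2001, Ch. IV
§3.1, proof of (1.29), p. 210). Let `0 ≤ Ψ ≤ C` be continuous, and let `k` be a function with
`Ψ(U t) ≤ k t` for `t > 0`, integrable on every `(0, T]` and with time means eventually `≤ B`.
Then `∫ Ψ dμ ≤ B`. (No measurability of `t ↦ Ψ(U t)` is needed.) [cite: FMRT2001, Ch. IV §3.1 (3.3)–(3.4)] -/
theorem IsTimeAverageMeasure.integral_le_of_forall_timeMean_le
    (hμ : IsTimeAverageMeasure Λ.longTimeAvg U μ)
    {Ψ : FunctionSpaces.Torus.energySpace d → ℝ} (hΨ : Continuous Ψ) (h0 : ∀ u, 0 ≤ Ψ u) {C : ℝ}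
    (hC : ∀ u, Ψ u ≤ C) {k : ℝ → ℝ} (hk : ∀ t, 0 < t → Ψ (U t) ≤ k t)
    (hki : ∀ T, 0 < T → IntegrableOn k (Ioc 0 T)) {B : ℝ} (hB : ∀ᶠ T in atTop, timeMean k T ≤ B) :
    ∫ v, Ψ v ∂μ ≤ B := by
  have habs : ∀ u, |Ψ u| ≤ C := fun u => by rw [abs_of_nonneg (h0 u)]; exact hC u
  rw [hμ.integral_eq hΨ habs]
  refine Λ.apply_le_of_eventually_le (isBoundedUnder_ge_timeMean fun t _ => habs _) ?_
  filter_upwards [hB, eventually_gt_atTop 0] with T hTB hT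
  refine le_trans ?_ hTB
  unfold timeMean
  rw [intervalIntegral.integral_of_le hT.le, intervalIntegral.integral_of_le hT.le]
  refine mul_le_mul_of_nonneg_left ?_ (inv_nonneg.2 hT.le)
  refine integral_mono_of_nonneg (ae_of_all _ fun t => h0 _) (hki T hT) ?_
  filter_upwards [ae_restrict_mem measurableSet_Ioc] with t ht
  exact hk t ht.1

end Torus

end Literature.Analysis.FluidPDE
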